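import Summits.Parity.BatemanHorn.Theorems.AlmostPrimeZerosLinearCappedRepulsionComposition
import Summits.Parity.BatemanHorn.Theorems.AlmostPrimeZerosLinearCappedRepulsionTilted
import Summits.Parity.BatemanHorn.Theorems.AlmostPrimeZerosLinearCappedRepulsionJensenCount
import Summits.Parity.BatemanHorn.Theorems.AlmostPrimeZerosLinearCappedRepulsionStieltjes

/-!
# Crux `LinearCappedRepulsion` (stmt-Parity-11327) — PROVED
(`Summit.Parity.BatemanHorn.Theses.AlmostPrimeZeros.LinearCappedRepulsion`, route AlmostPrimeZeros, rank 5)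

`T_X(x) := Σ_ρ ‖1 − ρ‖⁻²`, the sum over the roots (with multiplicity) of the almost-prime polynomial
`P_x(z) = Σ_{0 ≤ n ≤ x} z^{s(n)}` of the capped statistic `s(n) = Σ_{p^v ∥ n} min(v, 2)`, is
bounded for `x ≥ 2`.  Line `jensen-stieltjes-majorant` (crux protocol, lead prover): a ONE-SIDED
Selberg–Delange majorant of `P_x` carrying the harmonic exponent `(log x)^{Re z − 1}` on the disc
`‖z − 1‖ ≤ log log x / C` (`tiltedMajorant`, from the tree's contour engine run in upper-bound mode on
the difference of two Riesz means, with every constant explicit in `R = ‖z‖ ≍ log log x`), the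
Rankin majorant elsewhere (`stub_rankinMajorant`), Jensen's formula at the free centre `z = 1`
(`stub_jensenCount`), and the Stieltjes conversion (`stub_stieltjes`), composed by
`LinearCappedRepulsion_of_stubs`.

## References

* [MontgomeryVaughan2007] H. L. Montgomery, R. C. Vaughan, *Multiplicative Number Theory I*,
  CUP 2007, §7.4 (Theorems 7.17–7.18 and their proofs, pp. 177–179).
* [Tenenbaum2015] G. Tenenbaum, *Introduction to analytic and probabilistic number theory*, 3rd
  ed., AMS GSM 163, II.5–II.6.
* [Selberg1954] A. Selberg, *Note on a paper by L. G. Sathe*, J. Indian Math. Soc. 18 (1954) 83–87.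
-/

namespace Summit.Parity.BatemanHorn.Cruxes.LinearCappedRepulsion.JensenStieltjesMajorant

/-- **The crux `LinearCappedRepulsion` (route AlmostPrimeZeros, rank 5; item stmt-Parity-11327):**
`T_X(x) = Σ_ρ ‖1 − ρ‖⁻²`, over the roots of the almost-prime polynomial `Σ_{0≤n≤x} z^{s(n)}` of the
capped statistic `s(n) = Σ_{p^v ∥ n} min(v,2)`, is bounded for `x ≥ 2` — the route decl BY NAME, from
the six landed stubs of line `jensen-stieltjes-majorant` (one-sided Selberg–Delange majorant on the disc
`‖z − 1‖ ≤ log log x / C` → Jensen at the free centre `z = 1` → Stieltjes). -/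
theorem LinearCappedRepulsion_of :
    Summit.Parity.BatemanHorn.Theses.AlmostPrimeZeros.LinearCappedRepulsion :=
  LinearCappedRepulsion_of_stubs tiltedMajorant stub_rankinMajorant stub_jensenCount stub_stieltjes


end Summit.Parity.BatemanHorn.Cruxes.LinearCappedRepulsion.JensenStieltjesMajorant
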